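/-
Copyright (c) 2026 the pub-hodgecm-mathlib formalisation cell (harness21).  Prover seat hodgecm-mathlib-K2E1-p11 (g4), Track B ∕ K2-LIT, h413 = `stmt-HodgeConjecture-24833`,
R90-TF section S8 «ContSpec-n½», #2 road (G side), S8 dealer R90-CS-plan (g2) S8-R108 (1) ∕ S8-R110 ∕ S8-R111 («named for a successor»; spec = census
`R90/S8/CENSUS-MidAtomArchStable.K2E1-p11-g3.md`, 2026-09-04T23:13:33Z): the middle-pole residue atom `resGMidAtom ξ μω K′ ω` (★ p862682) is STABLE under `R(k)` for every
`k ∈ G(𝔸)` that commutes with `K′` and preserves the Borel height — the mid-atom twin of ★ p862921 `rightRegular_apply_mem_resGBlock` — together with its one content item: the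
residue function `g ↦ Fp g (3∕2)` of a generator is LEFT-`G(F)`-INVARIANT (identity theorem on the slit half-plane `{1 < Re} ∖ Sp`), and the continuation `Ec` is UNIQUE given `φ`.
-/
import Summits.HodgeConjecture.HodgeConjecture.Theorems.R90S8ResGMidAtomU3Defs          -- ★ p862682 (K2E1-p11 (g3)): `resGMidAtomGen`, `resGMidAtom ξ μω K′ ω`, `resGMidAtom_def`; brings ★ `flatSectionU`, ★ `eisensteinSeriesU_flatSectionU_rational_mul`, ★ `IsChiSectionPair.toAdelic_mul`
import Summits.HodgeConjecture.HodgeConjecture.Theorems.R90S8ResGBlockArchStableU3      -- ★ p862921 (K2E1-p11 (g3)) §1: `rightTranslation_mem_chiSectionSpacePair`, `eisensteinSeriesU_rightTranslation`; brings ★ `quotFun_rightTranslation`, ★ `quotientSubgroup_quasiSplit`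
import Mathlib.Analysis.Analytic.IsolatedZeros                                           -- Mathlib `AnalyticAt.frequently_eq_iff_eventually_eq`
import Mathlib.Analysis.Analytic.Uniqueness                                              -- Mathlib `AnalyticOnNhd.eqOn_of_preconnected_of_eventuallyEq` (identity theorem)
import Mathlib.Analysis.Complex.CauchyIntegral                                           -- Mathlib `DifferentiableOn.analyticOnNhd`
import Mathlib.Analysis.Complex.Convex                                                   -- Mathlib `convex_halfSpace_re_gt`, `convex_halfSpace_im_gt/lt`
import Mathlib.Analysis.Complex.ReImTopology                                             -- Mathlib `Complex.closure_reProdIm`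
import HarnessLib

/-!
# S8 #2 road (G side) — `R90S8ResGMidAtomArchStableU3`: the middle-pole residue atom `resGMidAtom ξ μω K′ ω` of `L²(U_{L∕L⁺}(3))` is STABLE under right translation `R(k)` by every
# `k ∈ G(𝔸)` that COMMUTES with `K′` and PRESERVES THE BOREL HEIGHT; the residue function of a generator is left-`G(F)`-invariant; the continuation `Ec` is unique given `φ`

Track B ∕ K2-LIT, crux h413 = `stmt-HodgeConjecture-24833`, route of record `HCCMUnconditional`; cell `hodgecm-mathlib`, R90-TF programme, section S8 «ContSpec-n½», socket #2's ED. 5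
sub-sockets EXH ∕ MID on the β-hull carrier (★ p862682).  THEOREMS ONLY (no `def`, no `instance`, no `notation`, no named-fact hypothesis, no `sorry`; default heartbeats); lane
`--supports stmt-HodgeConjecture-24833 --as helper` (count-neutral).  CLOSES NO SOCKET.  WHY (S8-R111 (d)): `resGMidBlock ξ μω = ClosedSubrep.generate …` is `R(G(𝔸))`-invariant by
construction, but the per-level ATOM `resGMidAtom ξ μω K′ ω` (a `Submodule`) is not — a consumer cutting the atoms by `K_∞`-type (as the K-type glue ★ `R90S8KTypeProjectionGlueU3`
does for `resGBlock`, with the letter `hstab` := ★ p862921) needs exactly this file's §4.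

THE MATHEMATICS ([MoeglinWaldspurger1995] II.1.1, II.1.5, IV.1.11, V.3.13; [BorelJacquet1979] §4.6; [Conway1978] IV §3 (identity theorem)).  A generator of the atom (★ `resGMidAtomGen`)
is an `L²` class a.e. equal to `x ↦ Fp((out x)⁻¹)(3∕2)`, `Fp` a pole letter at `z₀ = 3∕2` of a family `Ec` holomorphic on `{1 < Re} ∖ Sp` (`Sp` finite, REAL) with
`Ec z = E(flatSectionU φ z)` for `2 < Re z`, `φ ∈ V(χ₁, χ₂; K′, ω)` continuous.  For `k` with `H(gk) = H(g)` (`hHk`) and `k′k = kk′` on `K′` (`hcomm`): `r(k)φ ∈ V` (★ §1 of p862921),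
`flatSectionU (r(k)φ) z = r(k)(flatSectionU φ z)` (§3, `hHk`), so `Ec′ z g := Ec z (gk)` continues `E(flatSectionU (r(k)φ) ·)` (★ `eisensteinSeriesU_rightTranslation`) with the same
`Sp`, and `Fp′ g := Fp (gk)` is its pole letter; the translated class is `R(k) f = [x ↦ Fp′((out x)⁻¹)(3∕2)]` (★ `rightRegular_apply_coeFn` + ★ `quotFun_rightTranslation`) PROVIDED
the residue function `ψ : g ↦ Fp g (3∕2)` is left-`G(F)`-invariant — THE CONTENT (§2): `E(flatSectionU φ z)` is left-`G(F)`-invariant for every `z` (★ `eisensteinSeriesU_flatSectionU_rational_mul`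
fed by ★ `IsChiSectionPair.toAdelic_mul`, `χ₂` automorphic, ★ `quotientSubgroup_quasiSplit`), so `z ↦ Ec z (γg)` and `z ↦ Ec z g` agree on `{2 < Re}`; both are holomorphic on the slit
half-plane `{1 < Re} ∖ Sp`, whose open CONVEX quadrants `{1 < Re, ±Im > 0}` avoid the real set `Sp` — the identity theorem (Mathlib `AnalyticOnNhd.eqOn_of_preconnected_of_eventuallyEq`) gives
agreement on both quadrants, continuity at the real points gives agreement on the whole slit domain (§1 `eqOn_reSlit_of_eqOn_re_gt`); near `3∕2` the pole letters `Fp(γg) = (z − 3∕2)·Ec z (γg)`,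
`Fp g = (z − 3∕2)·Ec z g` then agree FREQUENTLY along `𝓝[≠] 3∕2` (the upper quadrant accumulates at every real point, Mathlib `Complex.closure_reProdIm`), hence at `3∕2` (Mathlib
`AnalyticAt.frequently_eq_iff_eventually_eq`).  The same argument with `γ := 1` and two continuation data `(Ec, Sp, Fp)`, `(Ec′, Sp′, Fp′)` of ONE `φ` gives UNIQUENESS: `Ec = Ec′` on
`{1 < Re} ∖ (Sp ∪ Sp′)` and `Fp g (3∕2) = Fp′ g (3∕2)` (§2) — the «payers plug their exported `Ec` by name» clause of ★ p862682's docstring, now a theorem.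
* §1 (pure complex analysis) `frequently_nhdsNE_re_gt_im_pos∕neg`, `eqOn_of_isPreconnected_of_eqOn_re_gt`, `eqOn_re_gt_im_pos∕neg_of_eqOn_re_gt`, **`eqOn_reSlit_of_eqOn_re_gt`**,
  `poleLetter_apply_eq_of_frequently_eq`.
* §2 (the print `U(J₃)`) **`midContinuation_quotientSubgroup_mul`**, **`midPoleLetter_apply_quotientSubgroup_mul`** (left-`G(F)`-invariance of `Ec` and of `g ↦ Fp g z₀`, every REAL
  `z₀` with `1 ≤ Re z₀`), `midContinuation_eqOn_of_clauses`, `midPoleLetter_apply_eq_of_clauses` (uniqueness given `φ`).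
* §3 `flatSectionU_rightTranslation`, **`rightRegular_apply_mem_resGMidAtomGen`** — generators go to generators.
* §4 **`rightRegular_apply_mem_resGMidAtom`** ∕ **`map_rightRegular_resGMidAtom_le`** — THE STABILITY LETTER for the mid atom (span by linearity, closure by continuity of `R(k)`).
HONEST LABEL: HC_CM is proved only modulo the 7 printed citations (2 remaining named inputs: hLiu418 = `stmt-HodgeConjecture-24832`, h413 = `stmt-HodgeConjecture-24833`) until rung 0
closes; REL ≠ ★ ≠ BUILT; a stability letter pays no socket; count-neutral.

## References
* [MoeglinWaldspurger1995] C. Mœglin, J.-L. Waldspurger, *Spectral Decomposition and Eisenstein Series* (1995), II.1.1, II.1.5, IV.1.11, V.3.13.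
* [BorelJacquet1979] A. Borel, H. Jacquet, *Automorphic forms and automorphic representations*, Corvallis PSPM 33.1 (1979), §4.6.
* [Conway1978] J. B. Conway, *Functions of One Complex Variable*, 2nd ed., GTM 11 (1978), IV §3 (Thm. 3.7, identity theorem).
* [Rogawski1990] J. D. Rogawski, *Automorphic Representations of Unitary Groups in Three Variables* (1990), §13.9 p. 229 (ii).
-/

set_option autoImplicit false
set_option linter.dupNamespace false  -- the mandated namespace `…HodgeConjecture.HodgeConjecture.R90.S8` (LEAD #1 L1) repeats the summit's segment

noncomputable section

open MeasureTheory Measure Set Filter Topology NumberField ContRepresentation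
open Literature.NumberTheory Literature.NumberTheory.Automorphic Literature.NumberTheory.Automorphic.UnitaryGroup Literature.NumberTheory.GaloisRepresentations AdelicGroupData
open Literature.NumberTheory.Automorphic.Arthur2013.Leaves.TECR Literature.NumberTheory.Rogawski1990
open Summit.HodgeConjecture.HodgeConjecture.Cruxes.H413.K2E1BorelEisensteinU
open Summit.HodgeConjecture.HodgeConjecture.Cruxes.H413.K2E1CharacterEisensteinU3PairDefs
open Summit.HodgeConjecture.HodgeConjecture.Cruxes.H413.K2E1ChiSectionSpaceU3PairDefs
open scoped ENNReal NNReal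

namespace Summit.HodgeConjecture.HodgeConjecture.R90.S8

/-! ## §1 Pure complex analysis: the identity theorem on the slit half-plane `{a < Re} ∖ S`, `S ⊆ ℝ`, and pole letters -/

section Complex

/-- **The open upper quadrant `{a < Re, 0 < Im}` accumulates at every real point `z` with `a ≤ Re z`** (`z ∈ closure = {a ≤ Re, 0 ≤ Im}`, Mathlib `Complex.closure_reProdIm`; `z` itself is not
in the quadrant). [cite: Conway1978, IV §3] -/
theorem frequently_nhdsNE_re_gt_im_pos {z : ℂ} {a : ℝ} (ha : a ≤ z.re) (hz : z.im = 0) : ∃ᶠ w in 𝓝[≠] z, a < w.re ∧ 0 < w.im := by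
  have hzQ : z ∉ Set.Ioi a ×ℂ Set.Ioi (0 : ℝ) := fun h => (Set.mem_Ioi.1 (Complex.mem_reProdIm.1 h).2).ne' hz
  have hcl : z ∈ closure ((Set.Ioi a ×ℂ Set.Ioi (0 : ℝ)) \ {z}) := by
    rw [Set.sdiff_singleton_eq_self hzQ, Complex.closure_reProdIm, closure_Ioi, closure_Ioi]
    exact Complex.mem_reProdIm.2 ⟨Set.mem_Ici.2 ha, Set.mem_Ici.2 hz.symm.le⟩
  exact (mem_closure_ne_iff_frequently_within.1 hcl).mono fun w hw => ⟨Set.mem_Ioi.1 (Complex.mem_reProdIm.1 hw).1, Set.mem_Ioi.1 (Complex.mem_reProdIm.1 hw).2⟩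

/-- The open lower quadrant `{a < Re, Im < 0}` accumulates at every real point `z` with `a ≤ Re z`. [cite: Conway1978, IV §3] -/
theorem frequently_nhdsNE_re_gt_im_neg {z : ℂ} {a : ℝ} (ha : a ≤ z.re) (hz : z.im = 0) : ∃ᶠ w in 𝓝[≠] z, a < w.re ∧ w.im < 0 := by
  have hzQ : z ∉ Set.Ioi a ×ℂ Set.Iio (0 : ℝ) := fun h => (Set.mem_Iio.1 (Complex.mem_reProdIm.1 h).2).ne hz
  have hcl : z ∈ closure ((Set.Ioi a ×ℂ Set.Iio (0 : ℝ)) \ {z}) := by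
    rw [Set.sdiff_singleton_eq_self hzQ, Complex.closure_reProdIm, closure_Ioi, closure_Iio]
    exact Complex.mem_reProdIm.2 ⟨Set.mem_Ici.2 ha, Set.mem_Iic.2 hz.le⟩
  exact (mem_closure_ne_iff_frequently_within.1 hcl).mono fun w hw => ⟨Set.mem_Ioi.1 (Complex.mem_reProdIm.1 hw).1, Set.mem_Iio.1 (Complex.mem_reProdIm.1 hw).2⟩

/-- **Identity theorem, propagation form**: two functions holomorphic on the slit domain `{a < Re} ∖ S` that agree on the half-plane `{b < Re}` agree on every OPEN PRECONNECTED `C ⊆ {a < Re} ∖ S`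
containing a point `z₁` with `b < Re z₁` (Mathlib `AnalyticOnNhd.eqOn_of_preconnected_of_eventuallyEq`, `DifferentiableOn.analyticOnNhd`). [cite: Conway1978, IV §3] -/
theorem eqOn_of_isPreconnected_of_eqOn_re_gt {u v : ℂ → ℂ} {a b : ℝ} {S C : Set ℂ}
    (hu : DifferentiableOn ℂ u ({z : ℂ | a < z.re} \ S)) (hv : DifferentiableOn ℂ v ({z : ℂ | a < z.re} \ S)) (h : ∀ z : ℂ, b < z.re → u z = v z)
    (hCo : IsOpen C) (hCc : IsPreconnected C) (hCS : C ⊆ {z : ℂ | a < z.re} \ S) {z₁ : ℂ} (hz₁ : z₁ ∈ C) (hb : b < z₁.re) : EqOn u v C :=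
  ((hu.mono hCS).analyticOnNhd hCo).eqOn_of_preconnected_of_eventuallyEq ((hv.mono hCS).analyticOnNhd hCo) hCc hz₁
    (Filter.eventually_of_mem ((isOpen_lt continuous_const Complex.continuous_re).mem_nhds hb) fun z hz => h z hz)

/-- **On the upper quadrant**: holomorphic on `{a < Re} ∖ S` with `S ⊆ ℝ` and equal on `{b < Re}` ⟹ equal on `{a < Re, 0 < Im}` (an open CONVEX set avoiding `S`, containing `(max a b + 1) + i`).
[cite: Conway1978, IV §3] -/
theorem eqOn_re_gt_im_pos_of_eqOn_re_gt {u v : ℂ → ℂ} {a b : ℝ} {S : Set ℂ} (hS : ∀ s ∈ S, s.im = 0)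
    (hu : DifferentiableOn ℂ u ({z : ℂ | a < z.re} \ S)) (hv : DifferentiableOn ℂ v ({z : ℂ | a < z.re} \ S)) (h : ∀ z : ℂ, b < z.re → u z = v z) :
    ∀ z : ℂ, a < z.re → 0 < z.im → u z = v z := fun _z hza hzi =>
  eqOn_of_isPreconnected_of_eqOn_re_gt (C := {z : ℂ | a < z.re} ∩ {z : ℂ | 0 < z.im}) hu hv h
    ((isOpen_lt continuous_const Complex.continuous_re).inter (isOpen_lt continuous_const Complex.continuous_im))
    ((convex_halfSpace_re_gt a).inter (convex_halfSpace_im_gt 0)).isPreconnected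
    (fun w hw => ⟨hw.1, fun hwS => (hw.2 : (0 : ℝ) < w.im).ne' (hS w hwS)⟩) (z₁ := ⟨max a b + 1, 1⟩)
    ⟨(le_max_left a b).trans_lt (lt_add_one _), (one_pos : (0 : ℝ) < 1)⟩ ((le_max_right a b).trans_lt (lt_add_one _)) ⟨hza, hzi⟩

/-- **On the lower quadrant**: holomorphic on `{a < Re} ∖ S` with `S ⊆ ℝ` and equal on `{b < Re}` ⟹ equal on `{a < Re, Im < 0}`. [cite: Conway1978, IV §3] -/
theorem eqOn_re_gt_im_neg_of_eqOn_re_gt {u v : ℂ → ℂ} {a b : ℝ} {S : Set ℂ} (hS : ∀ s ∈ S, s.im = 0)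
    (hu : DifferentiableOn ℂ u ({z : ℂ | a < z.re} \ S)) (hv : DifferentiableOn ℂ v ({z : ℂ | a < z.re} \ S)) (h : ∀ z : ℂ, b < z.re → u z = v z) :
    ∀ z : ℂ, a < z.re → z.im < 0 → u z = v z := fun _z hza hzi =>
  eqOn_of_isPreconnected_of_eqOn_re_gt (C := {z : ℂ | a < z.re} ∩ {z : ℂ | z.im < 0}) hu hv h
    ((isOpen_lt continuous_const Complex.continuous_re).inter (isOpen_lt Complex.continuous_im continuous_const))
    ((convex_halfSpace_re_gt a).inter (convex_halfSpace_im_lt 0)).isPreconnected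
    (fun w hw => ⟨hw.1, fun hwS => (hw.2 : w.im < (0 : ℝ)).ne (hS w hwS)⟩) (z₁ := ⟨max a b + 1, -1⟩)
    ⟨(le_max_left a b).trans_lt (lt_add_one _), (neg_one_lt_zero : (-1 : ℝ) < 0)⟩ ((le_max_right a b).trans_lt (lt_add_one _)) ⟨hza, hzi⟩

/-- **THE IDENTITY THEOREM ON THE SLIT HALF-PLANE**: two functions holomorphic on `{a < Re} ∖ S`, `S ⊆ ℝ` closed (e.g. finite), that agree on `{b < Re}` agree on ALL of `{a < Re} ∖ S` — on the
two quadrants by the identity theorem, at the real points by continuity (the upper quadrant accumulates there; Mathlib `tendsto_nhds_unique_of_frequently_eq`).  No connectedness of the slit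
domain is invoked. [cite: Conway1978, IV §3] -/
theorem eqOn_reSlit_of_eqOn_re_gt {u v : ℂ → ℂ} {a b : ℝ} {S : Set ℂ} (hS : ∀ s ∈ S, s.im = 0) (hSc : IsClosed S)
    (hu : DifferentiableOn ℂ u ({z : ℂ | a < z.re} \ S)) (hv : DifferentiableOn ℂ v ({z : ℂ | a < z.re} \ S)) (h : ∀ z : ℂ, b < z.re → u z = v z) :
    EqOn u v ({z : ℂ | a < z.re} \ S) := by
  intro z hz
  have hza : a < z.re := hz.1
  rcases lt_trichotomy 0 z.im with him | him | him
  · exact eqOn_re_gt_im_pos_of_eqOn_re_gt hS hu hv h z hza him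
  · have hU : IsOpen ({z : ℂ | a < z.re} \ S) := (isOpen_lt continuous_const Complex.continuous_re).sdiff hSc
    have hcu : ContinuousAt u z := (hu.differentiableAt (hU.mem_nhds hz)).continuousAt
    have hcv : ContinuousAt v z := (hv.differentiableAt (hU.mem_nhds hz)).continuousAt
    exact tendsto_nhds_unique_of_frequently_eq (hcu.tendsto.mono_left nhdsWithin_le_nhds) (hcv.tendsto.mono_left nhdsWithin_le_nhds)
      ((frequently_nhdsNE_re_gt_im_pos hza.le him.symm).mono fun w hw => eqOn_re_gt_im_pos_of_eqOn_re_gt hS hu hv h w hw.1 hw.2)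
  · exact eqOn_re_gt_im_neg_of_eqOn_re_gt hS hu hv h z hza him

/-- **Pole letters inherit frequent agreement**: if `F`, `G` are analytic at `z₀`, `F = (z − z₀)·u` and `G = (z − z₀)·v` on a punctured neighbourhood, and `u = v` FREQUENTLY along `𝓝[≠] z₀`, then
`F z₀ = G z₀` (`F = G` frequently, hence eventually near `z₀` — Mathlib `AnalyticAt.frequently_eq_iff_eventually_eq`). [cite: Conway1978, IV §3] -/
theorem poleLetter_apply_eq_of_frequently_eq {u v F G : ℂ → ℂ} {z₀ : ℂ} (hF : AnalyticAt ℂ F z₀) (hG : AnalyticAt ℂ G z₀)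
    (hFu : F =ᶠ[𝓝[≠] z₀] fun z => (z - z₀) * u z) (hGv : G =ᶠ[𝓝[≠] z₀] fun z => (z - z₀) * v z) (huv : ∃ᶠ z in 𝓝[≠] z₀, u z = v z) :
    F z₀ = G z₀ := by
  have hfr : ∃ᶠ z in 𝓝[≠] z₀, F z = G z := by
    refine ((hFu.and hGv).and_frequently huv).mono ?_
    rintro z ⟨⟨h1, h2⟩, h3⟩
    rw [h1, h2]
    exact congrArg (fun t : ℂ => (z - z₀) * t) h3
  exact ((hF.frequently_eq_iff_eventually_eq hG).1 hfr).self_of_nhds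

end Complex

/-! ## §2 At the print `U(J₃) = quasiSplit L⁺ L c 3`: left-`G(F)`-invariance of the continued family and of its pole letters; uniqueness of the continuation given `φ` -/

section Print

variable (L : Type) [Field L] [NumberField L] [IsCMField L]

/-- **THE CONTINUED FAMILY IS LEFT-`G(F)`-INVARIANT ON THE WHOLE SLIT DOMAIN**: for a `(χ₁, χ₂)`-pair-section `φ` with `χ₂` automorphic and continuation data `(Ec, Sp)` as in ★ `resGMidAtomGen`
(`Ec · g` holomorphic on `{1 < Re} ∖ Sp`, `Sp` finite REAL, `Ec z = E(flatSectionU φ z)` for `2 < Re z`): `Ec z (γ g) = Ec z g` for every `γ ∈ A_G·G(F) = G(F)`, every `g`, every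
`z ∈ {1 < Re} ∖ Sp` — on `{2 < Re}` this is the automorphy of the series (★ `eisensteinSeriesU_flatSectionU_rational_mul` fed by ★ `IsChiSectionPair.toAdelic_mul`, ★ `quotientSubgroup_quasiSplit`),
and §1 `eqOn_reSlit_of_eqOn_re_gt` propagates it. [cite: MoeglinWaldspurger1995, II.1.5, IV.1.11] [cite: Conway1978, IV §3] -/
theorem midContinuation_quotientSubgroup_mul {χ₁ : HeckeCharacter L} {χ₂ : ↥(TorusDict.torus (IsCMField.complexConj L)) →ₜ* ℂˣ}
    {φ : (quasiSplit (↥(maximalRealSubfield L)) L (IsCMField.complexConj L) 3).Adelic → ℂ} (hφ : IsChiSectionPair χ₁ χ₂ φ) (hχ₂ : TorusDict.IsAutomorphic (IsCMField.complexConj L) χ₂)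
    {Ec : ℂ → (quasiSplit (↥(maximalRealSubfield L)) L (IsCMField.complexConj L) 3).Adelic → ℂ} {Sp : Finset ℂ} (hSp : ∀ s ∈ Sp, s.im = 0)
    (hol : ∀ g, DifferentiableOn ℂ (fun z => Ec z g) ({z : ℂ | 1 < z.re} \ (↑Sp : Set ℂ))) (hEc : ∀ z : ℂ, 2 < z.re → Ec z = eisensteinSeriesU (flatSectionU φ z))
    {γ : (quasiSplit (↥(maximalRealSubfield L)) L (IsCMField.complexConj L) 3).Adelic} (hγ : γ ∈ (quasiSplit (↥(maximalRealSubfield L)) L (IsCMField.complexConj L) 3).quotientSubgroup)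
    (g : (quasiSplit (↥(maximalRealSubfield L)) L (IsCMField.complexConj L) 3).Adelic) {z : ℂ} (hz : z ∈ {z : ℂ | 1 < z.re} \ (↑Sp : Set ℂ)) :
    Ec z (γ * g) = Ec z g := by
  -- automorphy of the Borel Eisenstein series of the flat sections of `φ` (`φ` is left-`B(F)`-invariant: `χ₁` is a Hecke character, `χ₂` is automorphic)
  have hinv : ∀ w : ℂ, eisensteinSeriesU (flatSectionU φ w) (γ * g) = eisensteinSeriesU (flatSectionU φ w) g := fun w => by
    have hγ' := hγ
    rw [quotientSubgroup_quasiSplit] at hγ'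
    obtain ⟨γ₀, hγ₀⟩ := MonoidHom.mem_range.1 hγ'
    rw [← hγ₀]
    exact eisensteinSeriesU_flatSectionU_rational_mul (hφ.toAdelic_mul hχ₂) w γ₀ g
  refine eqOn_reSlit_of_eqOn_re_gt (u := fun w => Ec w (γ * g)) (v := fun w => Ec w g) (a := 1) (b := 2) (fun s hs => hSp s hs) (Sp.finite_toSet.isClosed) (hol (γ * g)) (hol g) (fun w hw => ?_) hz
  show Ec w (γ * g) = Ec w g
  rw [hEc w hw]
  exact hinv w

/-- **THE POLE LETTERS (RESIDUE FUNCTIONS) ARE LEFT-`G(F)`-INVARIANT**: with the data of `midContinuation_quotientSubgroup_mul` and a pole letter `Fp` at a REAL point `z₀` with `1 ≤ Re z₀`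
(`Fp g` analytic at `z₀`, `Fp g = (z − z₀)·Ec z g` on a punctured neighbourhood — ★ F6 §1 currency; `z₀ = 3∕2` for ★ `resGMidAtomGen`, `z₀ = 2` for the top pole): `Fp (γ g) z₀ = Fp g z₀`
for every `γ ∈ G(F)` — the two pole letters agree on the upper quadrant near `z₀`, which accumulates at `z₀` (§1). [cite: MoeglinWaldspurger1995, IV.1.11] [cite: Conway1978, IV §3] -/
theorem midPoleLetter_apply_quotientSubgroup_mul {χ₁ : HeckeCharacter L} {χ₂ : ↥(TorusDict.torus (IsCMField.complexConj L)) →ₜ* ℂˣ}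
    {φ : (quasiSplit (↥(maximalRealSubfield L)) L (IsCMField.complexConj L) 3).Adelic → ℂ} (hφ : IsChiSectionPair χ₁ χ₂ φ) (hχ₂ : TorusDict.IsAutomorphic (IsCMField.complexConj L) χ₂)
    {Ec : ℂ → (quasiSplit (↥(maximalRealSubfield L)) L (IsCMField.complexConj L) 3).Adelic → ℂ} {Sp : Finset ℂ} (hSp : ∀ s ∈ Sp, s.im = 0)
    (hol : ∀ g, DifferentiableOn ℂ (fun z => Ec z g) ({z : ℂ | 1 < z.re} \ (↑Sp : Set ℂ))) (hEc : ∀ z : ℂ, 2 < z.re → Ec z = eisensteinSeriesU (flatSectionU φ z))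
    {z₀ : ℂ} (hz₀ : 1 ≤ z₀.re) (hz₀im : z₀.im = 0)
    {Fp : (quasiSplit (↥(maximalRealSubfield L)) L (IsCMField.complexConj L) 3).Adelic → ℂ → ℂ} (hF : ∀ g, AnalyticAt ℂ (Fp g) z₀) (hFE : ∀ g, Fp g =ᶠ[𝓝[≠] z₀] fun z => (z - z₀) * Ec z g) :
    ∀ γ ∈ (quasiSplit (↥(maximalRealSubfield L)) L (IsCMField.complexConj L) 3).quotientSubgroup, ∀ g : (quasiSplit (↥(maximalRealSubfield L)) L (IsCMField.complexConj L) 3).Adelic,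
      Fp (γ * g) z₀ = Fp g z₀ := fun _γ hγ g =>
  poleLetter_apply_eq_of_frequently_eq (hF _) (hF g) (hFE _) (hFE g)
    ((frequently_nhdsNE_re_gt_im_pos hz₀ hz₀im).mono fun w hw => midContinuation_quotientSubgroup_mul L hφ hχ₂ hSp hol hEc hγ g ⟨hw.1, fun hwS => hw.2.ne' (hSp w hwS)⟩)

/-- **UNIQUENESS OF THE CONTINUATION GIVEN `φ`**: two continuation data `(Ec, Sp)`, `(Ec′, Sp′)` of the SAME section `φ` (each holomorphic off its own finite real set, each `= E(flatSectionU φ ·)`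
on `{2 < Re}`) agree on `{1 < Re} ∖ (Sp ∪ Sp′)` — §1 on the common slit domain; this is the «`Ec` is UNIQUE given `φ`, so payers plug their exported `Ec` by name» clause of ★ p862682.
[cite: MoeglinWaldspurger1995, IV.1.11] [cite: Conway1978, IV §3] -/
theorem midContinuation_eqOn_of_clauses {φ : (quasiSplit (↥(maximalRealSubfield L)) L (IsCMField.complexConj L) 3).Adelic → ℂ}
    {Ec Ec' : ℂ → (quasiSplit (↥(maximalRealSubfield L)) L (IsCMField.complexConj L) 3).Adelic → ℂ} {Sp Sp' : Finset ℂ} (hSp : ∀ s ∈ Sp, s.im = 0) (hSp' : ∀ s ∈ Sp', s.im = 0)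
    (hol : ∀ g, DifferentiableOn ℂ (fun z => Ec z g) ({z : ℂ | 1 < z.re} \ (↑Sp : Set ℂ))) (hEc : ∀ z : ℂ, 2 < z.re → Ec z = eisensteinSeriesU (flatSectionU φ z))
    (hol' : ∀ g, DifferentiableOn ℂ (fun z => Ec' z g) ({z : ℂ | 1 < z.re} \ (↑Sp' : Set ℂ))) (hEc' : ∀ z : ℂ, 2 < z.re → Ec' z = eisensteinSeriesU (flatSectionU φ z))
    (g : (quasiSplit (↥(maximalRealSubfield L)) L (IsCMField.complexConj L) 3).Adelic) {z : ℂ} (hz : 1 < z.re) (hzS : z ∉ Sp) (hzS' : z ∉ Sp') : Ec z g = Ec' z g := by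
  have hS : ∀ s ∈ ((↑Sp : Set ℂ) ∪ (↑Sp' : Set ℂ)), s.im = 0 := fun s hs => hs.elim (fun h => hSp s h) (fun h => hSp' s h)
  refine eqOn_reSlit_of_eqOn_re_gt (u := fun w => Ec w g) (v := fun w => Ec' w g) (a := 1) (b := 2) hS (Sp.finite_toSet.isClosed.union Sp'.finite_toSet.isClosed)
    ((hol g).mono (Set.sdiff_subset_sdiff_right Set.subset_union_left)) ((hol' g).mono (Set.sdiff_subset_sdiff_right Set.subset_union_right)) (fun w hw => ?_)
    ⟨hz, fun h => h.elim (fun h => hzS h) (fun h => hzS' h)⟩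
  show Ec w g = Ec' w g
  rw [hEc w hw, hEc' w hw]

/-- **UNIQUENESS OF THE RESIDUE VALUE GIVEN `φ`**: pole letters `Fp`, `Fp′` at a real `z₀` (`1 ≤ Re z₀`) of two continuation data of the SAME `φ` have the same value `Fp g z₀ = Fp′ g z₀` — so the
generator property of ★ `resGMidAtomGen` does not depend on which exported continuation a payer plugs. [cite: MoeglinWaldspurger1995, IV.1.11] [cite: Conway1978, IV §3] -/
theorem midPoleLetter_apply_eq_of_clauses {φ : (quasiSplit (↥(maximalRealSubfield L)) L (IsCMField.complexConj L) 3).Adelic → ℂ}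
    {Ec Ec' : ℂ → (quasiSplit (↥(maximalRealSubfield L)) L (IsCMField.complexConj L) 3).Adelic → ℂ} {Sp Sp' : Finset ℂ} (hSp : ∀ s ∈ Sp, s.im = 0) (hSp' : ∀ s ∈ Sp', s.im = 0)
    (hol : ∀ g, DifferentiableOn ℂ (fun z => Ec z g) ({z : ℂ | 1 < z.re} \ (↑Sp : Set ℂ))) (hEc : ∀ z : ℂ, 2 < z.re → Ec z = eisensteinSeriesU (flatSectionU φ z))
    (hol' : ∀ g, DifferentiableOn ℂ (fun z => Ec' z g) ({z : ℂ | 1 < z.re} \ (↑Sp' : Set ℂ))) (hEc' : ∀ z : ℂ, 2 < z.re → Ec' z = eisensteinSeriesU (flatSectionU φ z))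
    {z₀ : ℂ} (hz₀ : 1 ≤ z₀.re) (hz₀im : z₀.im = 0)
    {Fp Fp' : (quasiSplit (↥(maximalRealSubfield L)) L (IsCMField.complexConj L) 3).Adelic → ℂ → ℂ} (hF : ∀ g, AnalyticAt ℂ (Fp g) z₀) (hFE : ∀ g, Fp g =ᶠ[𝓝[≠] z₀] fun z => (z - z₀) * Ec z g)
    (hF' : ∀ g, AnalyticAt ℂ (Fp' g) z₀) (hFE' : ∀ g, Fp' g =ᶠ[𝓝[≠] z₀] fun z => (z - z₀) * Ec' z g)
    (g : (quasiSplit (↥(maximalRealSubfield L)) L (IsCMField.complexConj L) 3).Adelic) : Fp g z₀ = Fp' g z₀ :=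
  poleLetter_apply_eq_of_frequently_eq (hF g) (hF' g) (hFE g) (hFE' g)
    ((frequently_nhdsNE_re_gt_im_pos hz₀ hz₀im).mono fun w hw =>
      midContinuation_eqOn_of_clauses L hSp hSp' hol hEc hol' hEc' g hw.1 (fun h => hw.2.ne' (hSp w h)) (fun h => hw.2.ne' (hSp' w h)))

end Print

/-! ## §3 Generators go to generators under `R(k)`, `k` commuting with `K′` and preserving the Borel height -/

section Stable

variable (L : Type) [Field L] [NumberField L] [IsCMField L]
  (μ : Measure (quasiSplit (↥(maximalRealSubfield L)) L (IsCMField.complexConj L) 3).automorphicQuotient) [(quasiSplit (↥(maximalRealSubfield L)) L (IsCMField.complexConj L) 3).IsAutomorphicMeasure μ]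
  (ξ : OneDimAutRepH L) (μω : HeckeCharacter L)
  (K' : Subgroup (quasiSplit (↥(maximalRealSubfield L)) L (IsCMField.complexConj L) 3).Adelic) (ω : ↥K' →* ℂ)

omit [(quasiSplit (↥(maximalRealSubfield L)) L (IsCMField.complexConj L) 3).IsAutomorphicMeasure μ] in
/-- **Flat sections commute with height-preserving right translation**: `flatSectionU (r(k)φ) z = r(k)(flatSectionU φ z)` when `H(gk) = H(g)` for all `g`. [cite: MoeglinWaldspurger1995, II.1.5] -/
theorem flatSectionU_rightTranslation {k : (quasiSplit (↥(maximalRealSubfield L)) L (IsCMField.complexConj L) 3).Adelic}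
    (hHk : ∀ g : (quasiSplit (↥(maximalRealSubfield L)) L (IsCMField.complexConj L) 3).Adelic, borelHeight (g * k) = borelHeight g)
    (φ : (quasiSplit (↥(maximalRealSubfield L)) L (IsCMField.complexConj L) 3).Adelic → ℂ) (z : ℂ) :
    flatSectionU (rightTranslation (quasiSplit (↥(maximalRealSubfield L)) L (IsCMField.complexConj L) 3) k φ) z =
      rightTranslation (quasiSplit (↥(maximalRealSubfield L)) L (IsCMField.complexConj L) 3) k (flatSectionU φ z) := by
  funext g
  simp only [flatSectionU_apply, rightTranslation_apply, hHk g]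

/-- **GENERATORS GO TO GENERATORS**: for `k ∈ G(𝔸)` commuting with `K′` (`hcomm`) and preserving the Borel height (`hHk`), `R(k)` maps a generator of the middle-pole residue atom of `ξ` at
level `(K′, ω)` (★ `resGMidAtomGen`, data `(φ, Ec, Sp, Fp)`) to the generator with data `(r(k)φ, Ec(·)(· k), Sp, Fp(· k))`: `r(k)φ ∈ V` (★ `rightTranslation_mem_chiSectionSpacePair`), the
translated family continues `E(flatSectionU (r(k)φ) ·)` (§3 `flatSectionU_rightTranslation` + ★ `eisensteinSeriesU_rightTranslation`), the pole-letter clauses translate pointwise, and the class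
`R(k) f` is a.e. `x ↦ Fp((out x)⁻¹ k)(3∕2)` by ★ `rightRegular_apply_coeFn` + ★ `quotFun_rightTranslation` — whose left-`G(F)`-invariance input is §2 `midPoleLetter_apply_quotientSubgroup_mul`
(`χ₂ = ξ.ψ` automorphic: `ξ.hψ`). [cite: MoeglinWaldspurger1995, II.1.1, II.1.5, IV.1.11] [cite: BorelJacquet1979, §4.6] -/
theorem rightRegular_apply_mem_resGMidAtomGen {k : (quasiSplit (↥(maximalRealSubfield L)) L (IsCMField.complexConj L) 3).Adelic}
    (hHk : ∀ g : (quasiSplit (↥(maximalRealSubfield L)) L (IsCMField.complexConj L) 3).Adelic, borelHeight (g * k) = borelHeight g) (hcomm : ∀ k' ∈ K', k' * k = k * k')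
    {f : (quasiSplit (↥(maximalRealSubfield L)) L (IsCMField.complexConj L) 3).L2 μ} (hf : f ∈ resGMidAtomGen L μ ξ μω K' ω) :
    ((quasiSplit (↥(maximalRealSubfield L)) L (IsCMField.complexConj L) 3).rightRegular μ) k f ∈ resGMidAtomGen L μ ξ μω K' ω := by
  obtain ⟨φ, hφ, hφc, Ec, Sp, hSp, hol, hEc, Fp, hF, hFE, hae⟩ := hf
  -- the translated section is continuous
  have hck : Continuous (rightTranslation (quasiSplit (↥(maximalRealSubfield L)) L (IsCMField.complexConj L) 3) k φ) := by
    have h : rightTranslation (quasiSplit (↥(maximalRealSubfield L)) L (IsCMField.complexConj L) 3) k φ = fun g => φ (g * k) := funext fun g => rfl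
    rw [h]
    exact hφc.comp (continuous_id.mul continuous_const)
  -- THE CONTENT (§2): the residue function `g ↦ Fp g (3/2)` is left-`G(F)`-invariant
  have hinv : ∀ γ ∈ (quasiSplit (↥(maximalRealSubfield L)) L (IsCMField.complexConj L) 3).quotientSubgroup, ∀ g : (quasiSplit (↥(maximalRealSubfield L)) L (IsCMField.complexConj L) 3).Adelic,
      (fun g : (quasiSplit (↥(maximalRealSubfield L)) L (IsCMField.complexConj L) 3).Adelic => Fp g ((3 : ℂ) / 2)) (γ * g) =
        (fun g : (quasiSplit (↥(maximalRealSubfield L)) L (IsCMField.complexConj L) 3).Adelic => Fp g ((3 : ℂ) / 2)) g :=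
    midPoleLetter_apply_quotientSubgroup_mul L (isChiSectionPair_of_mem hφ) ξ.hψ (fun s hs => (hSp s hs).1) hol hEc (by norm_num) (by norm_num) hF hFE
  -- right translation on `G(𝔸)` = the left action on the quotient, for the invariant residue function
  have h3 := AdelicGroupData.quotFun_rightTranslation (φ := fun g : (quasiSplit (↥(maximalRealSubfield L)) L (IsCMField.complexConj L) 3).Adelic => Fp g ((3 : ℂ) / 2)) hinv k
  refine ⟨rightTranslation (quasiSplit (↥(maximalRealSubfield L)) L (IsCMField.complexConj L) 3) k φ, rightTranslation_mem_chiSectionSpacePair L hcomm hφ, hck,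
    fun z g => Ec z (g * k), Sp, hSp, fun g => hol (g * k), fun z hz => ?_, fun g => Fp (g * k), fun g => hF (g * k), fun g => hFE (g * k), ?_⟩
  · -- the continuation clause of the translated family
    funext g
    show Ec z (g * k) = eisensteinSeriesU (flatSectionU (rightTranslation (quasiSplit (↥(maximalRealSubfield L)) L (IsCMField.complexConj L) 3) k φ) z) g
    rw [flatSectionU_rightTranslation L hHk, eisensteinSeriesU_rightTranslation, hEc z hz]
  · -- the a.e. class of `R(k) f`
    have h1 := (quasiSplit (↥(maximalRealSubfield L)) L (IsCMField.complexConj L) 3).rightRegular_apply_coeFn μ k f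
    have h2 := (measurePreserving_smul k⁻¹ μ).quasiMeasurePreserving.ae_eq_comp hae
    exact h1.trans (h2.trans (Filter.Eventually.of_forall fun x => (congrFun h3 x).symm))

/-! ## §4 The stability letter: `R(k) (resGMidAtom ξ μω K′ ω) ≤ resGMidAtom ξ μω K′ ω` -/

/-- **THE STABILITY LETTER OF THE MIDDLE-POLE RESIDUE ATOM** (pointwise form): for `k ∈ G(𝔸)` commuting with `K′` and preserving the Borel height, `R(k)` maps `resGMidAtom ξ μω K′ ω` (★ p862682:
the CLOSED span of the generators) into itself — generators to generators (§3), span by linearity, closure by continuity of `R(k)`; at `K′ := ι_f(Kf)`, `ω := 1`, `k := ι_∞(k_∞)`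
(★ `commute_archToAdelic_finAdelicToAdelic`, height invariance of `K_∞`) this is the `K_∞`-stability a K-type cut of the mid atoms would consume (twin of ★ `rightRegular_apply_mem_resGBlock`).
[cite: MoeglinWaldspurger1995, II.1.5, V.3.13] [cite: BorelJacquet1979, §4.6] [cite: Rogawski1990, §13.9 p. 229 (ii)] -/
theorem rightRegular_apply_mem_resGMidAtom {k : (quasiSplit (↥(maximalRealSubfield L)) L (IsCMField.complexConj L) 3).Adelic}
    (hHk : ∀ g : (quasiSplit (↥(maximalRealSubfield L)) L (IsCMField.complexConj L) 3).Adelic, borelHeight (g * k) = borelHeight g) (hcomm : ∀ k' ∈ K', k' * k = k * k')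
    {v : (quasiSplit (↥(maximalRealSubfield L)) L (IsCMField.complexConj L) 3).L2 μ} (hv : v ∈ resGMidAtom L μ ξ μω K' ω) :
    ((quasiSplit (↥(maximalRealSubfield L)) L (IsCMField.complexConj L) 3).rightRegular μ) k v ∈ resGMidAtom L μ ξ μω K' ω := by
  -- `resGMidAtom = closure (span gens)`; `R(k)` is continuous linear, so it suffices to send the generators into the (closed) target
  rw [resGMidAtom_def] at hv ⊢
  refine (Submodule.topologicalClosure_minimal _ (Submodule.span_le.2 ?_)
    ((Submodule.isClosed_topologicalClosure _).preimage (((quasiSplit (↥(maximalRealSubfield L)) L (IsCMField.complexConj L) 3).rightRegular μ) k).continuous) :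
    (Submodule.span ℂ _).topologicalClosure ≤ ((Submodule.span ℂ _).topologicalClosure).comap
      ((((quasiSplit (↥(maximalRealSubfield L)) L (IsCMField.complexConj L) 3).rightRegular μ) k :
        (quasiSplit (↥(maximalRealSubfield L)) L (IsCMField.complexConj L) 3).L2 μ →L[ℂ] (quasiSplit (↥(maximalRealSubfield L)) L (IsCMField.complexConj L) 3).L2 μ) :
        (quasiSplit (↥(maximalRealSubfield L)) L (IsCMField.complexConj L) 3).L2 μ →ₗ[ℂ] (quasiSplit (↥(maximalRealSubfield L)) L (IsCMField.complexConj L) 3).L2 μ)) hv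
  intro f hf
  rw [SetLike.mem_coe, Submodule.mem_comap, ContinuousLinearMap.coe_coe]
  exact Submodule.le_topologicalClosure _ (Submodule.subset_span (rightRegular_apply_mem_resGMidAtomGen L μ ξ μω K' ω hHk hcomm hf))

/-- **THE STABILITY LETTER, lattice form**: `(resGMidAtom ξ μω K′ ω).map R(k) ≤ resGMidAtom ξ μω K′ ω` for `k` commuting with `K′` and preserving the Borel height — the shape of the `hS`∕`hstab`
binders of ★ `topologicalClosure_iSup_inf_le` ∕ ★ `R90S8KTypeProjectionGlueU3`. [cite: MoeglinWaldspurger1995, II.1.5, V.3.13] [cite: BorelJacquet1979, §4.6] -/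
theorem map_rightRegular_resGMidAtom_le {k : (quasiSplit (↥(maximalRealSubfield L)) L (IsCMField.complexConj L) 3).Adelic}
    (hHk : ∀ g : (quasiSplit (↥(maximalRealSubfield L)) L (IsCMField.complexConj L) 3).Adelic, borelHeight (g * k) = borelHeight g) (hcomm : ∀ k' ∈ K', k' * k = k * k') :
    (resGMidAtom L μ ξ μω K' ω).map ((((quasiSplit (↥(maximalRealSubfield L)) L (IsCMField.complexConj L) 3).rightRegular μ) k :
      (quasiSplit (↥(maximalRealSubfield L)) L (IsCMField.complexConj L) 3).L2 μ →L[ℂ] (quasiSplit (↥(maximalRealSubfield L)) L (IsCMField.complexConj L) 3).L2 μ) :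
      (quasiSplit (↥(maximalRealSubfield L)) L (IsCMField.complexConj L) 3).L2 μ →ₗ[ℂ] (quasiSplit (↥(maximalRealSubfield L)) L (IsCMField.complexConj L) 3).L2 μ) ≤ resGMidAtom L μ ξ μω K' ω := by
  rintro _ ⟨v, hv, rfl⟩
  exact rightRegular_apply_mem_resGMidAtom L μ ξ μω K' ω hHk hcomm hv

/-- **The hull needs no letter** (S8-R111 (d), for the record): `resGMidBlock ξ μω` is a `ClosedSubrep`, invariant under EVERY `R(k)` by construction. [cite: MoeglinWaldspurger1995, V.3.13] -/
theorem rightRegular_apply_mem_resGMidBlock (k : (quasiSplit (↥(maximalRealSubfield L)) L (IsCMField.complexConj L) 3).Adelic)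
    {v : (quasiSplit (↥(maximalRealSubfield L)) L (IsCMField.complexConj L) 3).L2 μ} (hv : v ∈ (resGMidBlock L μ ξ μω).toSubmodule) :
    ((quasiSplit (↥(maximalRealSubfield L)) L (IsCMField.complexConj L) 3).rightRegular μ) k v ∈ (resGMidBlock L μ ξ μω).toSubmodule :=
  (resGMidBlock L μ ξ μω).apply_mem k hv

end Stable

end Summit.HodgeConjecture.HodgeConjecture.R90.S8

end
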